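import Mathlib.MeasureTheory.Function.Floor
import Literature.Analysis.FluidPDE.LocalLeraySolutions
import HarnessLib

/-!
# Renormalising the pressure of a local Leray solution by a gauge patched in time

Analysis/FluidPDE support file (all results proved, [folklore]; no definitions, no named facts)
for the assembly of Rusin–Šverák's weak stability of `NS(u₀)`
(`rusin_sverak_leray_weak_stability`, `RusinSverakLerayStability.lean`; J. Funct. Anal. 260
(2011) = arXiv:0911.0500, Thm. 4.2 with Lemma 4.1 and Prop. 2.2) from its printed ingredients
(`RusinSverakLerayStabilityAssembly.lean`).

The a priori estimate of Lemma 4.1 (= Jia–Šverák 2013, Cor. 1) controls the pressure of a Leray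
solution only after subtraction of a function of time *depending on the cylinder*:
`∫∫_{Q̃_{x₀,r}} |p - p_{x₀,r}(t)|^{3/2} ≤ C r²`, `Q̃_{x₀,r} = B_r(x₀) × (0, r²)` ("for a suitable
function `p_{x₀,r}(t)` of `t`", p. 7; Jia–Šverák, remark after Lemma 2: "we need to choose some
appropriate constants `p_{x₀,R}(t)`"), whereas "the situation of Prop. 2.2" on the whole slab
`(0, ∞) × ℝ³` (`RusinSverak2011.CompactnessSituation`) needs *one* renormalised pressure
`q = p - c(t)` bounded in `L^{3/2}` on every compact subset. Since "we can change the pressure by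
any function depending on `t` only" (p. 4), one may take the gauge of the cylinder
`(0, (n+1)²) × B_{n+1}(0)` on the time band `[n, n+1)`: the **patched gauge**
`t ↦ c_{⌊t⌋}(t)`. This file proves the bookkeeping this requires:

* `exists_nat_subset_Ioo_prod_ball` — bounded subsets of the open slab lie in boxes
  `(0, N) × B_N(0)`, `N ∈ ℕ`; `volume_box_ne_top`;
* `setLIntegral_prod_of_fst` — Tonelli for functions of time, `∫∫_{I×B} F(t) = (∫_I F) |B|`;
* `lintegral_gauge_sub_gauge_le`, `lintegral_gauge_rpow_lt_top` — two gauges of the same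
  pressure on a set `S` differ by an `L^{3/2}(S)` function (`|c' - c| ≤ |p - c| + |p - c'|`), and a
  gauge is `L^{3/2}` in time as soon as `p` and `p - c` are `L^{3/2}` on `I × B`, `|B| > 0`;
* `measurable_gauge_floor`, `gauge_floor_of_mem_Ico` — the patched gauge;
* `lintegral_box_sub_gauge_floor_le` — **the uniform bound**: if
  `∫∫_{(0,(n+1)²)×B_{n+1}} |p - c_n(t)|^{3/2} ≤ b_n` for all `n`, then
  `∫∫_{(0,M)×B_M} |p - c_{⌊t⌋}(t)|^{3/2}` is bounded by an explicit function of `b` and `M` alone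
  (on the band `[n, n+1)` write `p - c_n = (p - c_M) - (c_n - c_M)` and compare `c_n`, `c_M` on
  the small cylinder, where both renormalise `p`); `patch_bound_lt_top`;
* `lintegral_box_gauge_floor_lt_top` — the patched gauge is `L^{3/2}` on boxes.

## Mathlib / tree search

Tree: `slab`, `mem_slab` (`WeakSolution.lean`). Mathlib: `lintegral_prod_mul`,
`Measure.prod_restrict`, `Measure.volume_eq_prod`, `ENNReal.rpow_add_le_mul_rpow_add_rpow`,
`lintegral_union_le`, `Finset.set_biUnion_insert`, `Nat.floor_eq_on_Ico`, `Nat.measurable_floor`,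
`measurable_from_prod_countable_left`, `ENNReal.mul_inv_cancel`. Nothing on "gauge"/"patch" for
pressures existed (`lean search`).

## References

* W. Rusin, V. Šverák, J. Funct. Anal. 260 (2011) = arXiv:0911.0500, §2 p. 4 ("we can change the
  pressure by any function depending on `t` only"), Lemma 4.1 p. 7.
* H. Jia, V. Šverák, SIAM J. Math. Anal. 45 (2013) = arXiv:1201.1592, Lemma 2 and the remark after
  it, Cor. 1 (p. 4).
-/

noncomputable section

open MeasureTheory TopologicalSpace Filter Set Function Metric
open _root_.Topology
open scoped ENNReal NNReal

namespace Literature.Analysis.FluidPDE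

/-! ## Boxes, Tonelli for functions of time, gauges -/

section Glue

/-- A bounded subset of the open slab `(0, ∞) × ℝ³` lies in a box `(0, N) × B_N(0)`, `N ≥ 1`
a natural number. [folklore] -/
theorem exists_nat_subset_Ioo_prod_ball {K : Set (ℝ × EuclideanSpace ℝ (Fin 3))}
    (hK : K ⊆ ((slab (EuclideanSpace ℝ (Fin 3)) (Ioi 0) isOpen_Ioi :
      Opens (ℝ × EuclideanSpace ℝ (Fin 3))) : Set (ℝ × EuclideanSpace ℝ (Fin 3))))
    (hKb : Bornology.IsBounded K) :
    ∃ N : ℕ, 1 ≤ N ∧ K ⊆ Ioo (0 : ℝ) N ×ˢ ball (0 : EuclideanSpace ℝ (Fin 3)) N := by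
  obtain ⟨R, hR⟩ := hKb.subset_closedBall 0
  refine ⟨⌈R⌉₊ + 1, by omega, fun z hz => ?_⟩
  have hzR : ‖z‖ ≤ R := by simpa using hR hz
  have h1 : ‖z.1‖ ≤ R := (norm_fst_le z).trans hzR
  have h2 : ‖z.2‖ ≤ R := (norm_snd_le z).trans hzR
  have hRN : R < ((⌈R⌉₊ + 1 : ℕ) : ℝ) := by
    push_cast
    exact (Nat.le_ceil R).trans_lt (lt_add_one _)
  have ht : z.1 ∈ Ioi (0 : ℝ) := mem_slab.1 (hK hz)
  refine ⟨⟨ht, ?_⟩, ?_⟩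
  · exact ((le_abs_self _).trans ((Real.norm_eq_abs _).symm.le.trans h1)).trans_lt hRN
  · exact mem_ball_zero_iff.2 (h2.trans_lt hRN)

/-- **Tonelli for a function of time**: `∫∫_{I × B} F(t) = (∫_I F) · |B|`. [folklore] -/
theorem setLIntegral_prod_of_fst (I : Set ℝ) (B : Set (EuclideanSpace ℝ (Fin 3)))
    {F : ℝ → ℝ≥0∞} (hF : Measurable F) :
    ∫⁻ z in I ×ˢ B, F z.1 = (∫⁻ t in I, F t) * volume B := by
  rw [Measure.volume_eq_prod ℝ (EuclideanSpace ℝ (Fin 3)), ← Measure.prod_restrict]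
  have e : (fun z : ℝ × EuclideanSpace ℝ (Fin 3) => F z.1) =
      fun z => F z.1 * (fun _ : EuclideanSpace ℝ (Fin 3) => (1 : ℝ≥0∞)) z.2 := by
    funext z; simp
  rw [e, lintegral_prod_mul hF.aemeasurable aemeasurable_const, lintegral_const,
    Measure.restrict_apply_univ, one_mul]

/-- `(a + b)^{3/2} ≤ √2 (a^{3/2} + b^{3/2})` applied to `‖x - y‖ ≤ ‖x‖ + ‖y‖`: the basic
pointwise inequality behind all gauge comparisons. [folklore] -/
theorem enorm_sub_rpow_three_halves_le (x y : ℝ) :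
    ‖x - y‖ₑ ^ (3 / 2 : ℝ) ≤
      2 ^ ((3 / 2 : ℝ) - 1) * (‖x‖ₑ ^ (3 / 2 : ℝ) + ‖y‖ₑ ^ (3 / 2 : ℝ)) :=
  calc ‖x - y‖ₑ ^ (3 / 2 : ℝ) ≤ (‖x‖ₑ + ‖y‖ₑ) ^ (3 / 2 : ℝ) := by gcongr; exact enorm_sub_le
    _ ≤ _ := ENNReal.rpow_add_le_mul_rpow_add_rpow _ _ (by norm_num)

/-- The constant `2^{1/2}` of `enorm_sub_rpow_three_halves_le` is finite. [folklore] -/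
theorem two_rpow_half_ne_top : (2 : ℝ≥0∞) ^ ((3 / 2 : ℝ) - 1) ≠ ∞ :=
  ENNReal.rpow_ne_top_of_nonneg (by norm_num) ENNReal.ofNat_ne_top

/-- **Two gauges of the same pressure differ by an `L^{3/2}` function**:
`∫∫_S |c' - c|^{3/2} ≤ √2 (∫∫_S |p - c|^{3/2} + ∫∫_S |p - c'|^{3/2})`. [folklore] -/
theorem lintegral_gauge_sub_gauge_le {p : ℝ → EuclideanSpace ℝ (Fin 3) → ℝ} {c c' : ℝ → ℝ}
    (hc : Measurable c) {S : Set (ℝ × EuclideanSpace ℝ (Fin 3))}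
    (hpm : AEStronglyMeasurable (uncurry p) (volume.restrict S)) :
    ∫⁻ z in S, ‖c' z.1 - c z.1‖ₑ ^ (3 / 2 : ℝ) ≤ 2 ^ ((3 / 2 : ℝ) - 1) *
      ((∫⁻ z in S, ‖p z.1 z.2 - c z.1‖ₑ ^ (3 / 2 : ℝ)) +
        ∫⁻ z in S, ‖p z.1 z.2 - c' z.1‖ₑ ^ (3 / 2 : ℝ)) := by
  have hmeas : AEMeasurable
      (fun z : ℝ × EuclideanSpace ℝ (Fin 3) => ‖p z.1 z.2 - c z.1‖ₑ ^ (3 / 2 : ℝ))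
      (volume.restrict S) :=
    (hpm.aemeasurable.sub (hc.comp measurable_fst).aemeasurable).enorm.pow_const _
  calc ∫⁻ z in S, ‖c' z.1 - c z.1‖ₑ ^ (3 / 2 : ℝ)
      ≤ ∫⁻ z in S, 2 ^ ((3 / 2 : ℝ) - 1) *
          (‖p z.1 z.2 - c z.1‖ₑ ^ (3 / 2 : ℝ) + ‖p z.1 z.2 - c' z.1‖ₑ ^ (3 / 2 : ℝ)) := by
        refine lintegral_mono fun z => ?_
        have e : c' z.1 - c z.1 = (p z.1 z.2 - c z.1) - (p z.1 z.2 - c' z.1) := by ring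
        rw [e]
        exact enorm_sub_rpow_three_halves_le _ _
    _ = _ := by rw [lintegral_const_mul' _ _ two_rpow_half_ne_top, lintegral_add_left' hmeas]

/-- **The gauge of a renormalised pressure is `L^{3/2}` in time**: if `p ∈ L^{3/2}(I × B)` and
`p - c(t) ∈ L^{3/2}(I × B)` with `|B| > 0`, then `c ∈ L^{3/2}(I)`. [folklore] -/
theorem lintegral_gauge_rpow_lt_top {p : ℝ → EuclideanSpace ℝ (Fin 3) → ℝ} {c : ℝ → ℝ}
    (hc : Measurable c) {I : Set ℝ} {B : Set (EuclideanSpace ℝ (Fin 3))} (hB : volume B ≠ 0)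
    (hpm : AEStronglyMeasurable (uncurry p) (volume.restrict (I ×ˢ B)))
    (hp : ∫⁻ z in I ×ˢ B, ‖p z.1 z.2‖ₑ ^ (3 / 2 : ℝ) < ∞)
    (hpc : ∫⁻ z in I ×ˢ B, ‖p z.1 z.2 - c z.1‖ₑ ^ (3 / 2 : ℝ) < ∞) :
    ∫⁻ t in I, ‖c t‖ₑ ^ (3 / 2 : ℝ) < ∞ := by
  have h0 := lintegral_gauge_sub_gauge_le (c := c) (c' := fun _ => 0) hc hpm
  simp only [zero_sub, enorm_neg, sub_zero] at h0
  have hint : ∫⁻ z in I ×ˢ B, ‖c z.1‖ₑ ^ (3 / 2 : ℝ) < ∞ :=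
    h0.trans_lt (ENNReal.mul_lt_top two_rpow_half_ne_top.lt_top
      (ENNReal.add_lt_top.2 ⟨hpc, hp⟩))
  rw [setLIntegral_prod_of_fst I B (hc.enorm.pow_const _)] at hint
  rcases ENNReal.mul_lt_top_iff.1 hint with h | h | h
  · exact h.1
  · simp [h]
  · exact absurd h hB

/-- The patched gauge `t ↦ c_{⌊t⌋}(t)` of a sequence of measurable gauges is measurable.
[folklore] -/
theorem measurable_gauge_floor {c : ℕ → ℝ → ℝ} (hc : ∀ n, Measurable (c n)) :
    Measurable fun t : ℝ => c ⌊t⌋₊ t := by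
  have h1 : Measurable fun q : ℝ × ℕ => c q.2 q.1 :=
    measurable_from_prod_countable_left fun n => hc n
  exact h1.comp (measurable_id.prodMk Nat.measurable_floor)

/-- On the band `t ∈ [n, n + 1)` the patched gauge is the `n`-th gauge. [folklore] -/
theorem gauge_floor_of_mem_Ico {c : ℕ → ℝ → ℝ} {n : ℕ} {t : ℝ} (ht : t ∈ Ico (n : ℝ) (n + 1)) :
    c ⌊t⌋₊ t = c n t := by
  rw [Nat.floor_eq_on_Ico n t ht]

end Glue

/-- Boxes `(0, N) × B_N` have finite measure. [folklore] -/
theorem volume_box_ne_top (N : ℕ) :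
    volume (Ioo (0 : ℝ) N ×ˢ ball (0 : EuclideanSpace ℝ (Fin 3)) N) ≠ ∞ :=
  ((measure_mono (Set.prod_mono Ioo_subset_Icc_self ball_subset_closedBall)).trans_lt
    ((isCompact_Icc.prod
      (isCompact_closedBall (0 : EuclideanSpace ℝ (Fin 3)) (N : ℝ))).measure_lt_top)).ne


/-! ## The patched gauge on a box -/

section Patch

/-- Finite subadditivity of the lower integral over a finite union of sets. [folklore] -/
theorem lintegral_biUnion_finset_le {α ι : Type*} [MeasurableSpace α] (μ : Measure α)
    (s : Finset ι) (S : ι → Set α) (f : α → ℝ≥0∞) :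
    ∫⁻ x in ⋃ i ∈ s, S i, f x ∂μ ≤ ∑ i ∈ s, ∫⁻ x in S i, f x ∂μ := by
  classical
  induction s using Finset.induction_on with
  | empty => simp
  | insert a s ha ih =>
    rw [Finset.set_biUnion_insert, Finset.sum_insert ha]
    exact (lintegral_union_le _ _ _).trans (by gcongr)

/-- **The box `(0, M) × B_M` is covered by the time bands `[n, n+1)`, `n < M`**, so a lower
integral over the box is at most the sum of the lower integrals over the bands. [folklore] -/
theorem lintegral_box_le_sum_bands (f : ℝ × EuclideanSpace ℝ (Fin 3) → ℝ≥0∞) (M : ℕ) :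
    ∫⁻ z in Ioo (0 : ℝ) M ×ˢ ball (0 : EuclideanSpace ℝ (Fin 3)) M, f z ≤
      ∑ n ∈ Finset.range M,
        ∫⁻ z in (Ico (n : ℝ) (n + 1) ∩ Ioo (0 : ℝ) M) ×ˢ ball (0 : EuclideanSpace ℝ (Fin 3)) M,
          f z := by
  refine (lintegral_mono_set (μ := volume) (f := f) fun z hz => ?_).trans
    (lintegral_biUnion_finset_le volume (Finset.range M) _ f)
  rw [mem_prod, mem_Ioo] at hz
  have ht0 : 0 ≤ z.1 := hz.1.1.le
  refine mem_iUnion₂.2 ⟨⌊z.1⌋₊, Finset.mem_range.2 ((Nat.floor_lt ht0).2 hz.1.2), ?_⟩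
  exact ⟨⟨⟨Nat.floor_le ht0, Nat.lt_floor_add_one z.1⟩, hz.1⟩, hz.2⟩

/-- The band `([n, n+1) ∩ (0, M)) × B_M` lies in the cylinder `(0, (m+1)²) × B_{m+1}` as soon as
`n ≤ m` and `M ≤ m + 1`. [folklore] -/
theorem band_subset_cylinder {n m M : ℕ} (hnm : n ≤ m) (hMm : M ≤ m + 1) :
    (Ico (n : ℝ) (n + 1) ∩ Ioo (0 : ℝ) M) ×ˢ ball (0 : EuclideanSpace ℝ (Fin 3)) M ⊆
      Ioo (0 : ℝ) (((m : ℝ) + 1) ^ 2) ×ˢ ball (0 : EuclideanSpace ℝ (Fin 3)) ((m : ℝ) + 1) := by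
  rintro z ⟨⟨⟨-, hz1⟩, hz0, -⟩, hz2⟩
  have hm0 : (0 : ℝ) ≤ m := Nat.cast_nonneg m
  have hMm' : (M : ℝ) ≤ (m : ℝ) + 1 := by exact_mod_cast hMm
  have hnm' : (n : ℝ) ≤ m := by exact_mod_cast hnm
  refine ⟨⟨hz0, ?_⟩, ball_subset_ball hMm' hz2⟩
  nlinarith

/-- The band `([n, n+1) ∩ (0, M)) × B_M` lies in `(0, (n+1)²) × B_M`. [folklore] -/
theorem band_subset_Ioo_sq_prod {n M : ℕ} :
    (Ico (n : ℝ) (n + 1) ∩ Ioo (0 : ℝ) M) ×ˢ ball (0 : EuclideanSpace ℝ (Fin 3)) M ⊆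
      Ioo (0 : ℝ) (((n : ℝ) + 1) ^ 2) ×ˢ ball (0 : EuclideanSpace ℝ (Fin 3)) M := by
  rintro z ⟨⟨⟨-, hz1⟩, hz0, -⟩, hz2⟩
  have hn0 : (0 : ℝ) ≤ n := Nat.cast_nonneg n
  refine ⟨⟨hz0, ?_⟩, hz2⟩
  nlinarith

/-- Cylinders `(0, (n+1)²) × B_{n+1}` increase with `n`. [folklore] -/
theorem cylinder_mono {n m : ℕ} (hnm : n ≤ m) :
    Ioo (0 : ℝ) (((n : ℝ) + 1) ^ 2) ×ˢ ball (0 : EuclideanSpace ℝ (Fin 3)) ((n : ℝ) + 1) ⊆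
      Ioo (0 : ℝ) (((m : ℝ) + 1) ^ 2) ×ˢ ball (0 : EuclideanSpace ℝ (Fin 3)) ((m : ℝ) + 1) := by
  have h : (n : ℝ) + 1 ≤ (m : ℝ) + 1 := by
    have : (n : ℝ) ≤ m := by exact_mod_cast hnm
    linarith
  have hn : (0 : ℝ) ≤ (n : ℝ) + 1 := by positivity
  exact prod_mono (Ioo_subset_Ioo le_rfl (pow_le_pow_left₀ hn h 2)) (ball_subset_ball h)

/-- Cylinders `(0, (n+1)²) × B_{n+1}` lie in the open slab `(0, ∞) × ℝ³`. [folklore] -/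
theorem cylinder_subset_slab (n : ℕ) :
    Ioo (0 : ℝ) (((n : ℝ) + 1) ^ 2) ×ˢ ball (0 : EuclideanSpace ℝ (Fin 3)) ((n : ℝ) + 1) ⊆
      ((slab (EuclideanSpace ℝ (Fin 3)) (Ioi 0) isOpen_Ioi :
        Opens (ℝ × EuclideanSpace ℝ (Fin 3))) : Set (ℝ × EuclideanSpace ℝ (Fin 3))) :=
  fun _ hz => mem_slab.2 hz.1.1

/-- Boxes `(0, M) × B_M` lie in the open slab `(0, ∞) × ℝ³`. [folklore] -/
theorem box_subset_slab (M : ℕ) :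
    Ioo (0 : ℝ) M ×ˢ ball (0 : EuclideanSpace ℝ (Fin 3)) M ⊆
      ((slab (EuclideanSpace ℝ (Fin 3)) (Ioi 0) isOpen_Ioi :
        Opens (ℝ × EuclideanSpace ℝ (Fin 3))) : Set (ℝ × EuclideanSpace ℝ (Fin 3))) :=
  fun _ hz => mem_slab.2 hz.1.1

/-- **Uniform `L^{3/2}` bound for the patched pressure `p - c_{⌊t⌋}(t)` on a box.** If the
`n`-th gauge renormalises `p` on the cylinder `(0, (n+1)²) × B_{n+1}` with
`∫∫ |p - c_n(t)|^{3/2} ≤ b_n`, then on `(0, M) × B_M` the patched pressure is bounded in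
`L^{3/2}` by a quantity depending only on `b` and `M` (the gauges `c_n`, `c_M` are compared on
the small cylinder, where both renormalise `p`). [folklore] -/
theorem lintegral_box_sub_gauge_floor_le {p : ℝ → EuclideanSpace ℝ (Fin 3) → ℝ}
    {c : ℕ → ℝ → ℝ} (hc : ∀ n, Measurable (c n))
    (hpm : AEStronglyMeasurable (uncurry p) (volume.restrict
      ((slab (EuclideanSpace ℝ (Fin 3)) (Ioi 0) isOpen_Ioi :
        Opens (ℝ × EuclideanSpace ℝ (Fin 3))) : Set (ℝ × EuclideanSpace ℝ (Fin 3)))))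
    {b : ℕ → ℝ≥0∞}
    (hb : ∀ n : ℕ, ∫⁻ z in Ioo (0 : ℝ) (((n : ℝ) + 1) ^ 2) ×ˢ
      ball (0 : EuclideanSpace ℝ (Fin 3)) ((n : ℝ) + 1), ‖p z.1 z.2 - c n z.1‖ₑ ^ (3 / 2 : ℝ) ≤ b n)
    (M : ℕ) :
    ∫⁻ z in Ioo (0 : ℝ) M ×ˢ ball (0 : EuclideanSpace ℝ (Fin 3)) M,
        ‖p z.1 z.2 - c ⌊z.1⌋₊ z.1‖ₑ ^ (3 / 2 : ℝ) ≤
      ∑ n ∈ Finset.range M, 2 ^ ((3 / 2 : ℝ) - 1) *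
        (b M + (volume (ball (0 : EuclideanSpace ℝ (Fin 3)) ((n : ℝ) + 1)))⁻¹ *
          (2 ^ ((3 / 2 : ℝ) - 1) * (b n + b M)) *
            volume (ball (0 : EuclideanSpace ℝ (Fin 3)) M)) := by
  refine (lintegral_box_le_sum_bands _ M).trans (Finset.sum_le_sum fun n hn => ?_)
  have hnM : n < M := Finset.mem_range.1 hn
  set S : Set (ℝ × EuclideanSpace ℝ (Fin 3)) :=
    (Ico (n : ℝ) (n + 1) ∩ Ioo (0 : ℝ) M) ×ˢ ball (0 : EuclideanSpace ℝ (Fin 3)) M with hS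
  have hSmeas : MeasurableSet S :=
    (measurableSet_Ico.inter measurableSet_Ioo).prod measurableSet_ball
  have hSM : S ⊆ Ioo (0 : ℝ) (((M : ℝ) + 1) ^ 2) ×ˢ
      ball (0 : EuclideanSpace ℝ (Fin 3)) ((M : ℝ) + 1) :=
    band_subset_cylinder hnM.le (Nat.le_succ M)
  have hSslab : S ⊆ ((slab (EuclideanSpace ℝ (Fin 3)) (Ioi 0) isOpen_Ioi :
      Opens (ℝ × EuclideanSpace ℝ (Fin 3))) : Set (ℝ × EuclideanSpace ℝ (Fin 3))) :=
    hSM.trans (cylinder_subset_slab M)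
  -- on the band the patched gauge is `c n`
  rw [setLIntegral_congr_fun hSmeas (g := fun z => ‖p z.1 z.2 - c n z.1‖ₑ ^ (3 / 2 : ℝ))
    fun z hz => by simp only [gauge_floor_of_mem_Ico hz.1.1]]
  -- pointwise split `p - c n = (p - c M) - (c n - c M)`
  have hpmS : AEStronglyMeasurable (uncurry p) (volume.restrict S) :=
    hpm.mono_measure (Measure.restrict_mono hSslab le_rfl)
  have hmeasM : AEMeasurable
      (fun z : ℝ × EuclideanSpace ℝ (Fin 3) => ‖p z.1 z.2 - c M z.1‖ₑ ^ (3 / 2 : ℝ))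
      (volume.restrict S) :=
    (hpmS.aemeasurable.sub ((hc M).comp measurable_fst).aemeasurable).enorm.pow_const _
  have step3 : ∫⁻ z in S, ‖p z.1 z.2 - c n z.1‖ₑ ^ (3 / 2 : ℝ) ≤ 2 ^ ((3 / 2 : ℝ) - 1) *
      ((∫⁻ z in S, ‖p z.1 z.2 - c M z.1‖ₑ ^ (3 / 2 : ℝ)) +
        ∫⁻ z in S, ‖c n z.1 - c M z.1‖ₑ ^ (3 / 2 : ℝ)) := by
    calc ∫⁻ z in S, ‖p z.1 z.2 - c n z.1‖ₑ ^ (3 / 2 : ℝ)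
        ≤ ∫⁻ z in S, 2 ^ ((3 / 2 : ℝ) - 1) *
            (‖p z.1 z.2 - c M z.1‖ₑ ^ (3 / 2 : ℝ) + ‖c n z.1 - c M z.1‖ₑ ^ (3 / 2 : ℝ)) := by
          refine lintegral_mono fun z => ?_
          have e : p z.1 z.2 - c n z.1 = (p z.1 z.2 - c M z.1) - (c n z.1 - c M z.1) := by ring
          rw [e]
          exact enorm_sub_rpow_three_halves_le _ _
      _ = _ := by rw [lintegral_const_mul' _ _ two_rpow_half_ne_top, lintegral_add_left' hmeasM]
  have step4 : ∫⁻ z in S, ‖p z.1 z.2 - c M z.1‖ₑ ^ (3 / 2 : ℝ) ≤ b M :=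
    (lintegral_mono_set hSM).trans (hb M)
  have step5 : ∫⁻ z in S, ‖c n z.1 - c M z.1‖ₑ ^ (3 / 2 : ℝ) ≤
      (∫⁻ t in Ioo (0 : ℝ) (((n : ℝ) + 1) ^ 2), ‖c n t - c M t‖ₑ ^ (3 / 2 : ℝ)) *
        volume (ball (0 : EuclideanSpace ℝ (Fin 3)) M) := by
    calc ∫⁻ z in S, ‖c n z.1 - c M z.1‖ₑ ^ (3 / 2 : ℝ)
        ≤ ∫⁻ z in Ioo (0 : ℝ) (((n : ℝ) + 1) ^ 2) ×ˢ ball (0 : EuclideanSpace ℝ (Fin 3)) M,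
            ‖c n z.1 - c M z.1‖ₑ ^ (3 / 2 : ℝ) := lintegral_mono_set band_subset_Ioo_sq_prod
      _ = _ := setLIntegral_prod_of_fst _ _ (((hc n).sub (hc M)).enorm.pow_const _)
  -- compare the two gauges on the small cylinder, where both renormalise `p`
  have hpmn : AEStronglyMeasurable (uncurry p) (volume.restrict
      (Ioo (0 : ℝ) (((n : ℝ) + 1) ^ 2) ×ˢ ball (0 : EuclideanSpace ℝ (Fin 3)) ((n : ℝ) + 1))) :=
    hpm.mono_measure (Measure.restrict_mono (cylinder_subset_slab n) le_rfl)
  have step6a : (∫⁻ t in Ioo (0 : ℝ) (((n : ℝ) + 1) ^ 2), ‖c n t - c M t‖ₑ ^ (3 / 2 : ℝ)) *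
      volume (ball (0 : EuclideanSpace ℝ (Fin 3)) ((n : ℝ) + 1)) ≤
        2 ^ ((3 / 2 : ℝ) - 1) * (b n + b M) := by
    rw [← setLIntegral_prod_of_fst _ _ (F := fun t => ‖c n t - c M t‖ₑ ^ (3 / 2 : ℝ))
      (((hc n).sub (hc M)).enorm.pow_const _)]
    calc ∫⁻ z in Ioo (0 : ℝ) (((n : ℝ) + 1) ^ 2) ×ˢ
          ball (0 : EuclideanSpace ℝ (Fin 3)) ((n : ℝ) + 1), ‖c n z.1 - c M z.1‖ₑ ^ (3 / 2 : ℝ)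
        ≤ 2 ^ ((3 / 2 : ℝ) - 1) *
          ((∫⁻ z in Ioo (0 : ℝ) (((n : ℝ) + 1) ^ 2) ×ˢ
              ball (0 : EuclideanSpace ℝ (Fin 3)) ((n : ℝ) + 1),
                ‖p z.1 z.2 - c M z.1‖ₑ ^ (3 / 2 : ℝ)) +
            ∫⁻ z in Ioo (0 : ℝ) (((n : ℝ) + 1) ^ 2) ×ˢ
              ball (0 : EuclideanSpace ℝ (Fin 3)) ((n : ℝ) + 1),
                ‖p z.1 z.2 - c n z.1‖ₑ ^ (3 / 2 : ℝ)) :=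
          lintegral_gauge_sub_gauge_le (c := c M) (c' := c n) (hc M) hpmn
      _ ≤ 2 ^ ((3 / 2 : ℝ) - 1) * (b M + b n) := by
          gcongr
          · exact (lintegral_mono_set (cylinder_mono hnM.le)).trans (hb M)
          · exact hb n
      _ = 2 ^ ((3 / 2 : ℝ) - 1) * (b n + b M) := by rw [add_comm (b M)]
  have hv0 : volume (ball (0 : EuclideanSpace ℝ (Fin 3)) ((n : ℝ) + 1)) ≠ 0 :=
    (measure_ball_pos volume _ (by positivity)).ne'
  have hvtop : volume (ball (0 : EuclideanSpace ℝ (Fin 3)) ((n : ℝ) + 1)) ≠ ∞ :=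
    measure_ball_lt_top.ne
  have step6 : ∫⁻ t in Ioo (0 : ℝ) (((n : ℝ) + 1) ^ 2), ‖c n t - c M t‖ₑ ^ (3 / 2 : ℝ) ≤
      (volume (ball (0 : EuclideanSpace ℝ (Fin 3)) ((n : ℝ) + 1)))⁻¹ *
        (2 ^ ((3 / 2 : ℝ) - 1) * (b n + b M)) := by
    set J := ∫⁻ t in Ioo (0 : ℝ) (((n : ℝ) + 1) ^ 2), ‖c n t - c M t‖ₑ ^ (3 / 2 : ℝ) with hJ
    set v := volume (ball (0 : EuclideanSpace ℝ (Fin 3)) ((n : ℝ) + 1)) with hv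
    calc J = J * v * v⁻¹ := by rw [mul_assoc, ENNReal.mul_inv_cancel hv0 hvtop, mul_one]
      _ ≤ (2 ^ ((3 / 2 : ℝ) - 1) * (b n + b M)) * v⁻¹ := by gcongr
      _ = v⁻¹ * (2 ^ ((3 / 2 : ℝ) - 1) * (b n + b M)) := mul_comm _ _
  -- combine
  calc ∫⁻ z in S, ‖p z.1 z.2 - c n z.1‖ₑ ^ (3 / 2 : ℝ)
      ≤ 2 ^ ((3 / 2 : ℝ) - 1) * ((∫⁻ z in S, ‖p z.1 z.2 - c M z.1‖ₑ ^ (3 / 2 : ℝ)) +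
          ∫⁻ z in S, ‖c n z.1 - c M z.1‖ₑ ^ (3 / 2 : ℝ)) := step3
    _ ≤ 2 ^ ((3 / 2 : ℝ) - 1) *
        (b M + (volume (ball (0 : EuclideanSpace ℝ (Fin 3)) ((n : ℝ) + 1)))⁻¹ *
          (2 ^ ((3 / 2 : ℝ) - 1) * (b n + b M)) *
            volume (ball (0 : EuclideanSpace ℝ (Fin 3)) M)) := by
        have step5' : ∫⁻ z in S, ‖c n z.1 - c M z.1‖ₑ ^ (3 / 2 : ℝ) ≤
            (volume (ball (0 : EuclideanSpace ℝ (Fin 3)) ((n : ℝ) + 1)))⁻¹ *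
              (2 ^ ((3 / 2 : ℝ) - 1) * (b n + b M)) *
                volume (ball (0 : EuclideanSpace ℝ (Fin 3)) M) :=
          step5.trans (by gcongr)
        gcongr

/-- The bound of `lintegral_box_sub_gauge_floor_le` is finite when the `b n` are. [folklore] -/
theorem patch_bound_lt_top {b : ℕ → ℝ≥0∞} (hb : ∀ n, b n ≠ ∞) (M : ℕ) :
    ∑ n ∈ Finset.range M, 2 ^ ((3 / 2 : ℝ) - 1) *
        (b M + (volume (ball (0 : EuclideanSpace ℝ (Fin 3)) ((n : ℝ) + 1)))⁻¹ *
          (2 ^ ((3 / 2 : ℝ) - 1) * (b n + b M)) *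
            volume (ball (0 : EuclideanSpace ℝ (Fin 3)) M)) < ∞ := by
  refine ENNReal.sum_lt_top.2 fun n _ => ENNReal.mul_lt_top two_rpow_half_ne_top.lt_top ?_
  refine ENNReal.add_lt_top.2 ⟨(hb M).lt_top, ENNReal.mul_lt_top (ENNReal.mul_lt_top ?_ ?_)
    measure_ball_lt_top⟩
  · exact ENNReal.inv_lt_top.2 (measure_ball_pos volume _ (by positivity))
  · exact ENNReal.mul_lt_top two_rpow_half_ne_top.lt_top
      (ENNReal.add_lt_top.2 ⟨(hb n).lt_top, (hb M).lt_top⟩)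

/-- **The patched gauge is `L^{3/2}` on boxes** (each `c_n` being `L^{3/2}` on `(0, (n+1)²)`).
[folklore] -/
theorem lintegral_box_gauge_floor_lt_top {c : ℕ → ℝ → ℝ} (hc : ∀ n, Measurable (c n))
    (hfin : ∀ n : ℕ, ∫⁻ t in Ioo (0 : ℝ) (((n : ℝ) + 1) ^ 2), ‖c n t‖ₑ ^ (3 / 2 : ℝ) < ∞)
    (M : ℕ) :
    ∫⁻ z in Ioo (0 : ℝ) M ×ˢ ball (0 : EuclideanSpace ℝ (Fin 3)) M,
      ‖c ⌊z.1⌋₊ z.1‖ₑ ^ (3 / 2 : ℝ) < ∞ := by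
  refine (lintegral_box_le_sum_bands _ M).trans_lt (ENNReal.sum_lt_top.2 fun n _ => ?_)
  have hSmeas : MeasurableSet ((Ico (n : ℝ) (n + 1) ∩ Ioo (0 : ℝ) M) ×ˢ
      ball (0 : EuclideanSpace ℝ (Fin 3)) M) :=
    (measurableSet_Ico.inter measurableSet_Ioo).prod measurableSet_ball
  rw [setLIntegral_congr_fun hSmeas (g := fun z => ‖c n z.1‖ₑ ^ (3 / 2 : ℝ))
    fun z hz => by simp only [gauge_floor_of_mem_Ico hz.1.1]]
  calc ∫⁻ z in (Ico (n : ℝ) (n + 1) ∩ Ioo (0 : ℝ) M) ×ˢ ball (0 : EuclideanSpace ℝ (Fin 3)) M,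
        ‖c n z.1‖ₑ ^ (3 / 2 : ℝ)
      ≤ ∫⁻ z in Ioo (0 : ℝ) (((n : ℝ) + 1) ^ 2) ×ˢ ball (0 : EuclideanSpace ℝ (Fin 3)) M,
          ‖c n z.1‖ₑ ^ (3 / 2 : ℝ) := lintegral_mono_set band_subset_Ioo_sq_prod
    _ = (∫⁻ t in Ioo (0 : ℝ) (((n : ℝ) + 1) ^ 2), ‖c n t‖ₑ ^ (3 / 2 : ℝ)) *
          volume (ball (0 : EuclideanSpace ℝ (Fin 3)) M) :=
        setLIntegral_prod_of_fst _ _ ((hc n).enorm.pow_const _)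
    _ < ∞ := ENNReal.mul_lt_top (hfin n) measure_ball_lt_top

end Patch

end Literature.Analysis.FluidPDE

end
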